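import Summits.BirchSwinnertonDyer.BirchSwinnertonDyer.Theorems.ResidualThetaTransportAtTwoSignedMuVanishingAtTwoPlusMultOneOldFamilyEngine
import Summits.BirchSwinnertonDyer.BirchSwinnertonDyer.Theorems.ResidualThetaTransportAtTwoSignedMuVanishingAtTwoPlusMultOneCongruence
import HarnessLib

/-!
# Route `ResidualThetaTransportAtTwo`, crux Kμ⁺ `SignedMuVanishingAtTwoPlus` (stmt-BirchSwinnertonDyer-20689), line
# `birth`, stub `stub_flatMuZeroAtTwo`: the old family for the level pattern `N_W = N₀ · q₁ · q₂` (two multiplicative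
# level-raising primes), CONSTRUCTED with the engine — `S = {1, q₁, q₂, q₁q₂}`, `H = D₁ + D_{q₁} + D_{q₂} + D_{q₁q₂}`

Cell `bsd-wall`, width seat `bsd-wall-rtt-p4-w2` (g4). THEOREMS ONLY; helper `--supports` the crux; closes nothing. BSD is not proved
by this. Sibling of `…MultOneOldFamilyPrime` (one prime) and `…MultOneOldFamilyPrimeSq` (`q·ℓ²`).

## What is proved
* `heckeT_q1_oldFamily_two_primes`, `heckeT_q2_oldFamily_two_primes`, `heckeT_oldFamily_two_primes_of_dvd_level`: `T_{q₁} H =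
  (a_{q₁}(g) + q₁)(D₁ + D_{q₂}) − (D_{q₁} + D_{q₁q₂})`, symmetrically for `q₂`, and `T_p H = a_p(g) H` for `p ∣ N₀`.
* `flatAtTwo_of_namedFacts_of_two_primes_level`: FLAT at `(W, f)` on the habitat⁺ with `N_W = N₀ q₁ q₂` from the four named facts, a
  congruent rational newform `g` of level `N₀` with `a_{q₁}(g), a_{q₂}(g)` even, `A q₁, A q₂` odd, `A p ≡ a_p(g)` for `p ∉ {q₁, q₂}`,
  and ONE odd doubled plus symbol of `g`; `flatAtTwo_turnkey_two_primes_level`: the per-class turnkey with `W[2] ≃+ A'[2]`.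

References: [AtkinLehner1970] Lemma 15; [DiamondShurman2005] §5.7, Prop. 5.8.5; [Buzzard2000LevelLoweringModTwo] Prop. 2.4;
[DarmonDiamondTaylor1995] Lemma 1.38; [SerreInventiones1972] Prop. 12; [Mazur1978]; [EmertonPollackWeston2006] §4.4.
-/

set_option autoImplicit false
set_option linter.dupNamespace false

noncomputable section

open scoped Classical MatrixGroups ModularForm

open CongruenceSubgroup Field WeierstrassCurve Literature.NumberTheory.EllipticCurves
  Literature.NumberTheory.EllipticCurves.ModularForms Literature.NumberTheory.EllipticCurves.Rank1Residual
  Literature.NumberTheory.IwasawaTheory Summit.BirchSwinnertonDyer.Rank1Residual.Supersingular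
  Summit.BirchSwinnertonDyer.BirchSwinnertonDyer.Theses.ResidualThetaTransportAtTwo

namespace Summit.BirchSwinnertonDyer.BirchSwinnertonDyer.Theorems.SignedMuAtTwo

namespace MultOneDictionary

/-! ## §1. `T_p` on `H = D₁ + D_{q₁} + D_{q₂} + D_{q₁q₂}` -/

section Hecke

variable {N₀ N : ℕ} [NeZero N₀] [NeZero N] {q₁ q₂ : ℕ} (hq₁ : q₁.Prime) (hq₂ : q₂.Prime) (hq : q₁ ≠ q₂)
  (hq₁N₀ : ¬ q₁ ∣ N₀) (hq₂N₀ : ¬ q₂ ∣ N₀) (hN : N₀ * (q₁ * q₂) = N) (g : CuspForm (Gamma0 N₀) 2) (hg : IsNewform0 g)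

include hq₁ hq₂ hq hq₁N₀ hN hg in
/-- **`T_{q₁}` on the old family**: `T_{q₁} (D₁ + D_{q₁} + D_{q₂} + D_{q₁q₂}) = (a_{q₁}(g) + q₁)(D₁ + D_{q₂}) − (D_{q₁} + D_{q₁q₂})`.
[cite: DiamondShurman2005, Prop. 5.2.2 (a), §5.7, Prop. 5.8.5] -/
theorem heckeT_q1_oldFamily_two_primes [NeZero q₁] [NeZero q₂] [NeZero (q₁ * q₂)] :
    heckeT (Gamma0 N) 2 q₁ (degeneracyMap0 N₀ N 1 2 g + degeneracyMap0 N₀ N q₁ 2 g + degeneracyMap0 N₀ N q₂ 2 g +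
        degeneracyMap0 N₀ N (q₁ * q₂) 2 g) =
      (cuspCoeff g q₁ + q₁) • (degeneracyMap0 N₀ N 1 2 g + degeneracyMap0 N₀ N q₂ 2 g) -
        (degeneracyMap0 N₀ N q₁ 2 g + degeneracyMap0 N₀ N (q₁ * q₂) 2 g) := by
  have h1 : N₀ * 1 ∣ N := ⟨q₁ * q₂, by rw [mul_one, hN]⟩
  have h₁ : N₀ * q₁ ∣ N := ⟨q₂, by rw [← hN]; ring⟩
  have h₂ : N₀ * q₂ ∣ N := ⟨q₁, by rw [← hN]; ring⟩
  have h₁₂ : N₀ * (q₁ * q₂) ∣ N := ⟨1, by rw [← hN]; ring⟩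
  have hq₁N : q₁ ∣ N := ⟨N₀ * q₂, by rw [← hN]; ring⟩
  have hq₁q₂ : ¬ q₁ ∣ q₂ := fun h ↦ hq ((Nat.prime_dvd_prime_iff_eq hq₁ hq₂).mp h)
  rw [map_add, map_add, map_add,
    heckeT_D_of_not_dvd (N := N) hg hq₁ hq₁N hq₁N₀ (t := 1) (tp := q₁) (by simp [hq₁.one_lt.ne']) (one_mul q₁).symm h1 h₁,
    heckeT_D_of_dvd (N := N) g hq₁ hq₁N (t := 1) (tp := q₁) (one_mul q₁).symm h1 h₁,
    heckeT_D_of_not_dvd (N := N) hg hq₁ hq₁N hq₁N₀ (t := q₂) (tp := q₁ * q₂) hq₁q₂ (mul_comm q₁ q₂) h₂ h₁₂,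
    heckeT_D_of_dvd (N := N) g hq₁ hq₁N (t := q₂) (tp := q₁ * q₂) (mul_comm q₁ q₂) h₂ h₁₂]
  module

include hq₁ hq₂ hq hq₂N₀ hN hg in
/-- **`T_{q₂}` on the old family**: `T_{q₂} (D₁ + D_{q₁} + D_{q₂} + D_{q₁q₂}) = (a_{q₂}(g) + q₂)(D₁ + D_{q₁}) − (D_{q₂} + D_{q₁q₂})`.
[cite: DiamondShurman2005, Prop. 5.2.2 (a), §5.7, Prop. 5.8.5] -/
theorem heckeT_q2_oldFamily_two_primes [NeZero q₁] [NeZero q₂] [NeZero (q₁ * q₂)] :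
    heckeT (Gamma0 N) 2 q₂ (degeneracyMap0 N₀ N 1 2 g + degeneracyMap0 N₀ N q₁ 2 g + degeneracyMap0 N₀ N q₂ 2 g +
        degeneracyMap0 N₀ N (q₁ * q₂) 2 g) =
      (cuspCoeff g q₂ + q₂) • (degeneracyMap0 N₀ N 1 2 g + degeneracyMap0 N₀ N q₁ 2 g) -
        (degeneracyMap0 N₀ N q₂ 2 g + degeneracyMap0 N₀ N (q₁ * q₂) 2 g) := by
  have h1 : N₀ * 1 ∣ N := ⟨q₁ * q₂, by rw [mul_one, hN]⟩
  have h₁ : N₀ * q₁ ∣ N := ⟨q₂, by rw [← hN]; ring⟩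
  have h₂ : N₀ * q₂ ∣ N := ⟨q₁, by rw [← hN]; ring⟩
  have h₁₂ : N₀ * (q₁ * q₂) ∣ N := ⟨1, by rw [← hN]; ring⟩
  have hq₂N : q₂ ∣ N := ⟨N₀ * q₁, by rw [← hN]; ring⟩
  have hq₂q₁ : ¬ q₂ ∣ q₁ := fun h ↦ hq ((Nat.prime_dvd_prime_iff_eq hq₂ hq₁).mp h).symm
  rw [map_add, map_add, map_add,
    heckeT_D_of_not_dvd (N := N) hg hq₂ hq₂N hq₂N₀ (t := 1) (tp := q₂) (by simp [hq₂.one_lt.ne']) (one_mul q₂).symm h1 h₂,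
    heckeT_D_of_not_dvd (N := N) hg hq₂ hq₂N hq₂N₀ (t := q₁) (tp := q₁ * q₂) hq₂q₁ rfl h₁ h₁₂,
    heckeT_D_of_dvd (N := N) g hq₂ hq₂N (t := 1) (tp := q₂) (one_mul q₂).symm h1 h₂,
    heckeT_D_of_dvd (N := N) g hq₂ hq₂N (t := q₁) (tp := q₁ * q₂) rfl h₁ h₁₂]
  module

include hq₁ hq₂ hq₁N₀ hq₂N₀ hN hg in
/-- **`T_p` on the old family for `p ∣ N₀`**: `T_p H = a_p(g) H`. [cite: DiamondShurman2005, Prop. 5.2.2 (a), Prop. 5.8.5 and §5.7] -/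
theorem heckeT_oldFamily_two_primes_of_dvd_level [NeZero q₁] [NeZero q₂] [NeZero (q₁ * q₂)] {p : ℕ} (hp : p.Prime)
    (hpN₀ : p ∣ N₀) :
    (haveI : NeZero p := ⟨hp.ne_zero⟩; heckeT (Gamma0 N) 2 p (degeneracyMap0 N₀ N 1 2 g + degeneracyMap0 N₀ N q₁ 2 g +
        degeneracyMap0 N₀ N q₂ 2 g + degeneracyMap0 N₀ N (q₁ * q₂) 2 g)) =
      cuspCoeff g p • (degeneracyMap0 N₀ N 1 2 g + degeneracyMap0 N₀ N q₁ 2 g + degeneracyMap0 N₀ N q₂ 2 g +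
        degeneracyMap0 N₀ N (q₁ * q₂) 2 g) := by
  haveI : NeZero p := ⟨hp.ne_zero⟩
  have h1 : N₀ * 1 ∣ N := ⟨q₁ * q₂, by rw [mul_one, hN]⟩
  have h₁ : N₀ * q₁ ∣ N := ⟨q₂, by rw [← hN]; ring⟩
  have h₂ : N₀ * q₂ ∣ N := ⟨q₁, by rw [← hN]; ring⟩
  have h₁₂ : N₀ * (q₁ * q₂) ∣ N := ⟨1, by rw [← hN]; ring⟩
  have hpq₁ : ¬ p ∣ q₁ := fun h ↦ hq₁N₀ (((Nat.prime_dvd_prime_iff_eq hp hq₁).mp h) ▸ hpN₀)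
  have hpq₂ : ¬ p ∣ q₂ := fun h ↦ hq₂N₀ (((Nat.prime_dvd_prime_iff_eq hp hq₂).mp h) ▸ hpN₀)
  have hp1 : ¬ p ∣ 1 := by simp [hp.one_lt.ne']
  have hpq₁₂ : ¬ p ∣ q₁ * q₂ := fun h ↦ ((Nat.Prime.dvd_mul hp).mp h).elim hpq₁ hpq₂
  rw [map_add, map_add, map_add, heckeT_D_of_dvd_level (N := N) hg hp hpN₀ hp1 h1,
    heckeT_D_of_dvd_level (N := N) hg hp hpN₀ hpq₁ h₁, heckeT_D_of_dvd_level (N := N) hg hp hpN₀ hpq₂ h₂,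
    heckeT_D_of_dvd_level (N := N) hg hp hpN₀ hpq₁₂ h₁₂, smul_add, smul_add, smul_add]

end Hecke

/-! ## §2. FLAT on the habitat⁺ for `N_W = N₀ · q₁ · q₂` -/

section Habitat

variable {W : WeierstrassCurve ℚ} [W.IsElliptic] [W.IsGloballyMinimal]

/-- **FLAT at `(W, f)` for `N_W = N₀ · q₁ · q₂`, old family constructed.** `W/ℚ` globally minimal, good supersingular at `2`,
`a₂(W) = 0`, `Δ_W < 0`, newform `f` (eigenvalues `A p`); `N_W = N₀ q₁ q₂` with distinct primes `q₁, q₂ ∤ N₀`; `g` a normalised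
newform of level `N₀` with rational coefficients and eigenvalues `B p`; parities `B q₁`, `B q₂` even, `A q₁`, `A q₂` odd;
`A p ≡ B p (mod 2)` for every prime `p ∉ {q₁, q₂}`; ONE odd `2([b/4^k]⁺_g − [0]⁺_g)`; the four named facts. THEN `2 ∤ L♭` for every
Pollack pair of `f` at `2`. [cite: Buzzard2000LevelLoweringModTwo, Prop. 2.4] [cite: DarmonDiamondTaylor1995, §1.6 Lemma 1.38]
[cite: SerreInventiones1972, §1.11 Prop. 12] [cite: Mazur1978, Thm. 1] [cite: EmertonPollackWeston2006, §4.4]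
[cite: DiamondShurman2005, §5.7, Prop. 5.8.5] -/
theorem flatAtTwo_of_namedFacts_of_two_primes_level (hBuz : buzzard2000_multiplicityOne_gamma0)
    (hSe : serre1972_supersingular_decompositionSubgroup_image) (hSD : heckeSelfDual_torsionBy_J0)
    (hMK : mazurKenku_exists_cyclic_isogeny)
    (hss : GoodSS W 2) (ha : W.frobeniusTrace 2 = 0) (hΔ : W.Δ < 0) [NeZero (W.conductorNorm ℤ)]
    {f : CuspForm (Gamma0 (W.conductorNorm ℤ)) 2} (hf : IsNewformOf W f)
    (A : ℕ → ℤ) (hA : ∀ p : ℕ, p.Prime → cuspCoeff f p = (A p : ℂ))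
    {N₀ q₁ q₂ : ℕ} [NeZero N₀] (hq₁ : q₁.Prime) (hq₂ : q₂.Prime) (hq : q₁ ≠ q₂) (hq₁N₀ : ¬ q₁ ∣ N₀) (hq₂N₀ : ¬ q₂ ∣ N₀)
    (hN : N₀ * (q₁ * q₂) = W.conductorNorm ℤ)
    (g : CuspForm (Gamma0 N₀) 2) (hg : IsNewform0 g) (hQg : coeffField g = ⊥)
    (B : ℕ → ℤ) (hB : ∀ p : ℕ, p.Prime → cuspCoeff g p = (B p : ℂ))
    (hBq₁ : Even (B q₁)) (hBq₂ : Even (B q₂)) (hAq₁ : Odd (A q₁)) (hAq₂ : Odd (A q₂))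
    (hcongr : ∀ p : ℕ, p.Prime → p ≠ q₁ → p ≠ q₂ → ((A p : ℤ) : ZMod 2) = ((B p : ℤ) : ZMod 2))
    (hres : ∃ k : ℕ, 1 ≤ k ∧ ∃ b : ℤ, Odd b ∧ ∃ m : ℤ, Odd m ∧
      ratPlusSymbol g ((b : ℚ) / 4 ^ k) = ratPlusSymbol g 0 + (m : ℚ) / 2) :
    ∀ Lplus Lminus : IwasawaAlgebra 2, IsPollackPair f 2 Lplus Lminus → ¬ PowerSeries.C (2 : ℤ_[2]) ∣ Lminus := by
  haveI : NeZero q₁ := ⟨hq₁.ne_zero⟩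
  haveI : NeZero q₂ := ⟨hq₂.ne_zero⟩
  haveI : NeZero (q₁ * q₂) := ⟨mul_ne_zero hq₁.ne_zero hq₂.ne_zero⟩
  have h2N : ¬ 2 ∣ W.conductorNorm ℤ := by
    rw [W.dvd_conductorNorm_iff_not_hasGoodReductionAtPrime 2, not_not]
    exact hss.1
  have hNdvd : ∀ {m : ℕ}, m ∣ q₁ * q₂ → N₀ * m ∣ W.conductorNorm ℤ := fun {m} hm ↦ by
    rw [← hN]; exact Nat.mul_dvd_mul_left N₀ hm
  have h2N₀ : ¬ 2 ∣ N₀ := fun h ↦ h2N (h.trans ⟨q₁ * q₂, hN.symm⟩)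
  have hq₁odd : Odd q₁ := hq₁.odd_of_ne_two (by rintro rfl; exact h2N ((dvd_mul_left 2 N₀).trans (hNdvd (dvd_mul_right 2 _))))
  have hq₂odd : Odd q₂ := hq₂.odd_of_ne_two (by rintro rfl; exact h2N ((dvd_mul_left 2 N₀).trans (hNdvd (dvd_mul_left 2 _))))
  have h1 : N₀ * 1 ∣ W.conductorNorm ℤ := hNdvd (one_dvd _)
  have h₁ : N₀ * q₁ ∣ W.conductorNorm ℤ := hNdvd (dvd_mul_right q₁ _)
  have h₂ : N₀ * q₂ ∣ W.conductorNorm ℤ := hNdvd (dvd_mul_left q₂ _)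
  have h₁₂ : N₀ * (q₁ * q₂) ∣ W.conductorNorm ℤ := hNdvd dvd_rfl
  have hΩg : plusPeriod g ≠ 0 := (IsNewform0.plusPeriod_pos_holds hg hQg).ne'
  have hA2 : A 2 = 0 := by
    have := hA 2 Nat.prime_two
    rw [hf.2 2, W.LFunction_apply_prime_eq_frobeniusTrace 2 hss.1, ha] at this
    exact_mod_cast this.symm
  have haev : Even (B 2) := by
    by_cases h2q₁ : (2 : ℕ) = q₁
    · rw [h2q₁]; exact hBq₁
    by_cases h2q₂ : (2 : ℕ) = q₂
    · rw [h2q₂]; exact hBq₂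
    have h := hcongr 2 Nat.prime_two h2q₁ h2q₂
    rw [hA2, Int.cast_zero] at h
    exact even_iff_two_dvd.mpr ((ZMod.intCast_zmod_eq_zero_iff_dvd _ 2).mp h.symm)
  let H : CuspForm (Gamma0 (W.conductorNorm ℤ)) 2 := degeneracyMap0 N₀ (W.conductorNorm ℤ) 1 2 g +
    degeneracyMap0 N₀ (W.conductorNorm ℤ) q₁ 2 g + degeneracyMap0 N₀ (W.conductorNorm ℤ) q₂ 2 g +
    degeneracyMap0 N₀ (W.conductorNorm ℤ) (q₁ * q₂) 2 g
  have hHdef : H = degeneracyMap0 N₀ (W.conductorNorm ℤ) 1 2 g + degeneracyMap0 N₀ (W.conductorNorm ℤ) q₁ 2 g +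
      degeneracyMap0 N₀ (W.conductorNorm ℤ) q₂ 2 g + degeneracyMap0 N₀ (W.conductorNorm ℤ) (q₁ * q₂) 2 g := rfl
  have hHint : ∀ γ, ∃ m : ℤ, (cuspSymbol H γ).re = m * (plusPeriod g / 2) :=
    integral_add g (integral_add g (integral_add g (integral_degeneracyMap0 g hΩg h1) (integral_degeneracyMap0 g hΩg h₁))
      (integral_degeneracyMap0 g hΩg h₂)) (integral_degeneracyMap0 g hΩg h₁₂)
  let δ : ℕ → (Gamma0 (W.conductorNorm ℤ) →* Gamma0 N₀) := fun t ↦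
    if t = q₁ then Gamma0.degeneracyConj N₀ _ q₁ h₁
    else if t = q₂ then Gamma0.degeneracyConj N₀ _ q₂ h₂
    else if t = q₁ * q₂ then Gamma0.degeneracyConj N₀ _ (q₁ * q₂) h₁₂
    else Gamma0.degeneracyConj N₀ _ 1 h1
  have hq₁1 : q₁ ≠ 1 := hq₁.one_lt.ne'
  have hq₂1 : q₂ ≠ 1 := hq₂.one_lt.ne'
  have hq₁₂1 : q₁ * q₂ ≠ 1 := fun h ↦ hq₁1 (Nat.eq_one_of_mul_eq_one_right h)
  have hq₂_q₁ : q₂ ≠ q₁ := fun h ↦ hq h.symm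
  have hq₁₂_q₁ : q₁ * q₂ ≠ q₁ := fun h ↦ by
    have h' : q₁ * q₂ = q₁ * 1 := by rw [h, mul_one]
    exact hq₂1 (Nat.eq_of_mul_eq_mul_left hq₁.pos h')
  have hq₁₂_q₂ : q₁ * q₂ ≠ q₂ := fun h ↦ by
    have h' : q₁ * q₂ = 1 * q₂ := by rw [h, one_mul]
    exact hq₁1 (Nat.eq_of_mul_eq_mul_right hq₂.pos h')
  have hδ1 : δ 1 = Gamma0.degeneracyConj N₀ _ 1 h1 := by
    simp only [δ, if_neg hq₁1.symm, if_neg hq₂1.symm, if_neg hq₁₂1.symm]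
  have hδq₁ : δ q₁ = Gamma0.degeneracyConj N₀ _ q₁ h₁ := by simp only [δ, if_pos rfl]
  have hδq₂ : δ q₂ = Gamma0.degeneracyConj N₀ _ q₂ h₂ := by simp [δ, hq₂_q₁]
  have hδq₁₂ : δ (q₁ * q₂) = Gamma0.degeneracyConj N₀ _ (q₁ * q₂) h₁₂ := by simp [δ, hq₁₂_q₁, hq₁₂_q₂]
  have hHsym : ∀ γ : Gamma0 (W.conductorNorm ℤ), cuspSymbol H γ = ∑ t ∈ ({1, q₁, q₂, q₁ * q₂} : Finset ℕ), cuspSymbol g (δ t γ) := by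
    intro γ
    rw [Finset.sum_insert (by simp [hq₁1.symm, hq₂1.symm, hq₁₂1.symm]), Finset.sum_insert (by simp [hq, hq₁₂_q₁.symm]),
      Finset.sum_pair hq₁₂_q₂.symm, hδ1, hδq₁, hδq₂, hδq₁₂, hHdef, cuspSymbol_add, cuspSymbol_add, cuspSymbol_add,
      cuspSymbol_degeneracyMap0 h1, cuspSymbol_degeneracyMap0 h₁, cuspSymbol_degeneracyMap0 h₂, cuspSymbol_degeneracyMap0 h₁₂]
    ring
  refine flatAtTwo_of_namedFacts hBuz hSe hSD hMK hss ha hΔ hf A hA g hg hQg h2N₀ B hB haev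
    (fun p hp hpN ↦ hcongr p hp (by intro h; subst h; exact hpN ((dvd_mul_left _ N₀).trans h₁))
      (by intro h; subst h; exact hpN ((dvd_mul_left _ N₀).trans h₂)))
    {1, q₁, q₂, q₁ * q₂} ⟨1, by simp⟩ (fun t ht ↦ ?_) δ (fun t ht γ ↦ ?_) (fun t ht γ ↦ ?_) (fun t ht γ ↦ ?_)
    (fun t ht γ ↦ ?_) (fun t ht γ ↦ ?_) H hHsym (fun p hp hpN ↦ ?_) (fun p hp hpN γ σ hσ mσ mγ hmσ hmγ ↦ ?_) hres
  · simp only [Finset.mem_insert, Finset.mem_singleton] at ht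
    rcases ht with rfl | rfl | rfl | rfl
    exacts [odd_one, hq₁odd, hq₂odd, hq₁odd.mul hq₂odd]
  · simp only [Finset.mem_insert, Finset.mem_singleton] at ht
    rcases ht with rfl | rfl | rfl | rfl
    · rw [hδ1]; rfl
    · rw [hδq₁]; rfl
    · rw [hδq₂]; rfl
    · rw [hδq₁₂]; rfl
  · simp only [Finset.mem_insert, Finset.mem_singleton] at ht
    rcases ht with rfl | rfl | rfl | rfl
    · rw [hδ1]; exact Gamma0.degeneracyConjElt_apply_zero_one h1 γ
    · rw [hδq₁]; exact Gamma0.degeneracyConjElt_apply_zero_one h₁ γ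
    · rw [hδq₂]; exact Gamma0.degeneracyConjElt_apply_zero_one h₂ γ
    · rw [hδq₁₂]; exact Gamma0.degeneracyConjElt_apply_zero_one h₁₂ γ
  · simp only [Finset.mem_insert, Finset.mem_singleton] at ht
    rcases ht with rfl | rfl | rfl | rfl
    · rw [hδ1]; rfl
    · rw [hδq₁]; rfl
    · rw [hδq₂]; rfl
    · rw [hδq₁₂]; rfl
  · simp only [Finset.mem_insert, Finset.mem_singleton] at ht
    rcases ht with rfl | rfl | rfl | rfl
    · rw [hδ1]; rfl
    · rw [hδq₁]; rfl
    · rw [hδq₂]; rfl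
    · rw [hδq₁₂]; rfl
  · have hγ := γ.2
    rw [Gamma0_mem] at hγ
    have hNc : ((W.conductorNorm ℤ : ℕ) : ℤ) ∣ (γ : SL(2, ℤ)) 1 0 := (ZMod.intCast_zmod_eq_zero_iff_dvd _ _).mp hγ
    have key : ∀ {t : ℕ}, N₀ * t ∣ W.conductorNorm ℤ → (t : ℤ) ∣ (γ : SL(2, ℤ)) 1 0 := fun {t} h ↦
      (Int.natCast_dvd_natCast.mpr ((dvd_mul_left t N₀).trans h)).trans hNc
    simp only [Finset.mem_insert, Finset.mem_singleton] at ht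
    rcases ht with rfl | rfl | rfl | rfl
    exacts [key h1, key h₁, key h₂, key h₁₂]
  · haveI : NeZero p := ⟨hp.ne_zero⟩
    rw [hHdef, map_add, map_add, map_add, heckeT_D_of_not_dvd_level' hg hp hpN h1, heckeT_D_of_not_dvd_level' hg hp hpN h₁,
      heckeT_D_of_not_dvd_level' hg hp hpN h₂, heckeT_D_of_not_dvd_level' hg hp hpN h₁₂, hB p hp, ← smul_add, ← smul_add,
      ← smul_add]
  · haveI : NeZero p := ⟨hp.ne_zero⟩
    have hpcases : p ∣ N₀ ∨ p = q₁ ∨ p = q₂ := by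
      rw [← hN] at hpN
      rcases (Nat.Prime.dvd_mul hp).mp hpN with h | h
      · exact Or.inl h
      · rcases (Nat.Prime.dvd_mul hp).mp h with h | h
        · exact Or.inr (Or.inl ((Nat.prime_dvd_prime_iff_eq hp hq₁).mp h))
        · exact Or.inr (Or.inr ((Nat.prime_dvd_prime_iff_eq hp hq₂).mp h))
    rcases hpcases with hpN₀ | rfl | rfl
    · have hpq₁ : p ≠ q₁ := by rintro rfl; exact hq₁N₀ hpN₀
      have hpq₂ : p ≠ q₂ := by rintro rfl; exact hq₂N₀ hpN₀
      have h2 : (2 : ℤ) ∣ B p - A p := (ZMod.intCast_eq_intCast_iff_dvd_sub _ _ _).mp (hcongr p hp hpq₁ hpq₂)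
      obtain ⟨b, hb⟩ := h2
      refine hbad_of_two_smul g hΩg H ((b : ℂ) • H) (integral_zsmul g hHint b) (A p) ?_ γ σ hσ mσ mγ hmσ hmγ
      rw [hHdef, heckeT_oldFamily_two_primes_of_dvd_level hq₁ hq₂ hq₁N₀ hq₂N₀ hN g hg hp hpN₀, hB p hp, ← hHdef, smul_smul,
        ← add_smul]
      congr 1
      have : (B p : ℂ) = (A p : ℂ) + 2 * (b : ℂ) := by
        have h' : (B p : ℤ) = A p + 2 * b := by linarith
        exact_mod_cast h'
      rw [this]
    · obtain ⟨b, hb⟩ := hBq₁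
      obtain ⟨c, hc⟩ := hAq₁
      obtain ⟨r, hr⟩ := hq₁odd
      refine hbad_of_two_smul g hΩg H
        (((b + r - c : ℤ) : ℂ) • (degeneracyMap0 N₀ (W.conductorNorm ℤ) 1 2 g + degeneracyMap0 N₀ (W.conductorNorm ℤ) q₂ 2 g) +
          ((-c - 1 : ℤ) : ℂ) • (degeneracyMap0 N₀ (W.conductorNorm ℤ) p 2 g + degeneracyMap0 N₀ (W.conductorNorm ℤ) (p * q₂) 2 g))
        (integral_add g (integral_zsmul g (integral_add g (integral_degeneracyMap0 g hΩg h1) (integral_degeneracyMap0 g hΩg h₂)) _)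
          (integral_zsmul g (integral_add g (integral_degeneracyMap0 g hΩg h₁) (integral_degeneracyMap0 g hΩg h₁₂)) _))
        (A p) ?_ γ σ hσ mσ mγ hmσ hmγ
      rw [hHdef, heckeT_q1_oldFamily_two_primes hq₁ hq₂ hq hq₁N₀ hN g hg, hB p hp]
      have e1 : ((B p : ℤ) : ℂ) = 2 * (b : ℂ) := by rw [hb]; push_cast; ring
      have e2 : ((A p : ℤ) : ℂ) = 2 * (c : ℂ) + 1 := by rw [hc]; push_cast; ring
      have e3 : ((p : ℕ) : ℂ) = 2 * (r : ℂ) + 1 := by rw [hr]; push_cast; ring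
      rw [e1, e2, e3]
      push_cast
      module
    · obtain ⟨b, hb⟩ := hBq₂
      obtain ⟨c, hc⟩ := hAq₂
      obtain ⟨r, hr⟩ := hq₂odd
      refine hbad_of_two_smul g hΩg H
        (((b + r - c : ℤ) : ℂ) • (degeneracyMap0 N₀ (W.conductorNorm ℤ) 1 2 g + degeneracyMap0 N₀ (W.conductorNorm ℤ) q₁ 2 g) +
          ((-c - 1 : ℤ) : ℂ) • (degeneracyMap0 N₀ (W.conductorNorm ℤ) p 2 g + degeneracyMap0 N₀ (W.conductorNorm ℤ) (q₁ * p) 2 g))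
        (integral_add g (integral_zsmul g (integral_add g (integral_degeneracyMap0 g hΩg h1) (integral_degeneracyMap0 g hΩg h₁)) _)
          (integral_zsmul g (integral_add g (integral_degeneracyMap0 g hΩg h₂) (integral_degeneracyMap0 g hΩg h₁₂)) _))
        (A p) ?_ γ σ hσ mσ mγ hmσ hmγ
      rw [hHdef, heckeT_q2_oldFamily_two_primes hq₁ hq₂ hq hq₂N₀ hN g hg, hB p hp]
      have e1 : ((B p : ℤ) : ℂ) = 2 * (b : ℂ) := by rw [hb]; push_cast; ring
      have e2 : ((A p : ℤ) : ℂ) = 2 * (c : ℂ) + 1 := by rw [hc]; push_cast; ring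
      have e3 : ((p : ℕ) : ℂ) = 2 * (r : ℂ) + 1 := by rw [hr]; push_cast; ring
      rw [e1, e2, e3]
      push_cast
      module

/-- **Per-class turnkey, pattern `N_W = N₀ · q₁ · q₂`.** As `flatAtTwo_of_namedFacts_of_two_primes_level`, with the congruence
`A p ≡ B p (mod 2)` at the good primes discharged from an equivariant `W[2] ≃+ A'[2]` for an anchor curve `A'` of conductor
dividing `N_W` whose newform is `g` (`…MultOneCongruence.eigenvalue_congr_two_of_geomTorsion_equiv`); what remains displayed is:
`B 2` even, `B q₁, B q₂` even, `A q₁, A q₂` odd, `A p ≡ B p` at the primes `p ∣ N₀`, and ONE odd doubled plus symbol of `g`.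
[cite: Buzzard2000LevelLoweringModTwo, Prop. 2.4] [cite: DarmonDiamondTaylor1995, §1.6 Lemma 1.38]
[cite: SerreInventiones1972, §1.11 Prop. 12] [cite: Mazur1978, Thm. 1] [cite: DiamondShurman2005, §5.7, Prop. 5.8.5] -/
theorem flatAtTwo_turnkey_two_primes_level (hBuz : buzzard2000_multiplicityOne_gamma0)
    (hSe : serre1972_supersingular_decompositionSubgroup_image) (hSD : heckeSelfDual_torsionBy_J0)
    (hMK : mazurKenku_exists_cyclic_isogeny)
    (hss : GoodSS W 2) (ha : W.frobeniusTrace 2 = 0) (hΔ : W.Δ < 0) [NeZero (W.conductorNorm ℤ)]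
    {f : CuspForm (Gamma0 (W.conductorNorm ℤ)) 2} (hf : IsNewformOf W f)
    (A : ℕ → ℤ) (hA : ∀ p : ℕ, p.Prime → cuspCoeff f p = (A p : ℂ))
    (A' : WeierstrassCurve ℚ) [A'.IsElliptic] (hNA : A'.conductorNorm ℤ ∣ W.conductorNorm ℤ)
    (e : geomTorsion W (2 : ℕ) ≃+ geomTorsion A' (2 : ℕ))
    (he : ∀ (σ : absoluteGaloisGroup ℚ) (P : geomTorsion W (2 : ℕ)), e (σ • P) = σ • e P)
    {N₀ q₁ q₂ : ℕ} [NeZero N₀] (hq₁ : q₁.Prime) (hq₂ : q₂.Prime) (hq : q₁ ≠ q₂) (hq₁N₀ : ¬ q₁ ∣ N₀) (hq₂N₀ : ¬ q₂ ∣ N₀)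
    (hN : N₀ * (q₁ * q₂) = W.conductorNorm ℤ)
    (g : CuspForm (Gamma0 N₀) 2) (hg : IsNewformOf A' g)
    (B : ℕ → ℤ) (hB : ∀ p : ℕ, p.Prime → cuspCoeff g p = (B p : ℂ)) (hB2 : Even (B 2))
    (hBq₁ : Even (B q₁)) (hBq₂ : Even (B q₂)) (hAq₁ : Odd (A q₁)) (hAq₂ : Odd (A q₂))
    (hcongr₀ : ∀ p : ℕ, p.Prime → p ∣ N₀ → ((A p : ℤ) : ZMod 2) = ((B p : ℤ) : ZMod 2))
    (hres : ∃ k : ℕ, 1 ≤ k ∧ ∃ b : ℤ, Odd b ∧ ∃ m : ℤ, Odd m ∧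
      ratPlusSymbol g ((b : ℚ) / 4 ^ k) = ratPlusSymbol g 0 + (m : ℚ) / 2) :
    ∀ Lplus Lminus : IwasawaAlgebra 2, IsPollackPair f 2 Lplus Lminus → ¬ PowerSeries.C (2 : ℤ_[2]) ∣ Lminus := by
  have hA2 : A 2 = 0 := by
    have := hA 2 Nat.prime_two
    rw [hf.2 2, W.LFunction_apply_prime_eq_frobeniusTrace 2 hss.1, ha] at this
    exact_mod_cast this.symm
  have hgood := eigenvalue_congr_two_of_geomTorsion_equiv W A' e he hNA hf hg A B hA hB (by rw [hA2]; exact Even.zero) hB2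
  refine flatAtTwo_of_namedFacts_of_two_primes_level hBuz hSe hSD hMK hss ha hΔ hf A hA hq₁ hq₂ hq hq₁N₀ hq₂N₀ hN g hg.1
    hg.coeffField_eq_bot B hB hBq₁ hBq₂ hAq₁ hAq₂ (fun p hp hpq₁ hpq₂ ↦ ?_) hres
  by_cases hpN : p ∣ W.conductorNorm ℤ
  · rw [← hN] at hpN
    rcases (Nat.Prime.dvd_mul hp).mp hpN with h | h
    · exact hcongr₀ p hp h
    · rcases (Nat.Prime.dvd_mul hp).mp h with h | h
      · exact absurd ((Nat.prime_dvd_prime_iff_eq hp hq₁).mp h) hpq₁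
      · exact absurd ((Nat.prime_dvd_prime_iff_eq hp hq₂).mp h) hpq₂
  · exact hgood p hp hpN

end Habitat

end MultOneDictionary

end Summit.BirchSwinnertonDyer.BirchSwinnertonDyer.Theorems.SignedMuAtTwo

end
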